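import Summits.CriticalPhenomena.PercolationContinuityZ3.Theorems.Transplant.SkelNeg1ChoiceO
import Summits.CriticalPhenomena.PercolationContinuityZ3.Theorems.Transplant.SkelRootSeedLaw
import HarnessLib

/-!
# N1 (the {±1} node), WITH ORIENTATION, (R) obligation in the LAW-CARRYING form (design owner's ruling 2026-08-21 15:23Z, NEG-SCOPE B.12,
# HOME/prim-bschramm-p3-g9/N1-R-PLAN-v2.md): `Skelφ.kitAtRun_of_oblRHNMW` (the root residue as `Skel.RootOblTW`),
# `PlanarSkeletonNeg.samePDropOfSkeletonNeg₁_of_residuesNOW`, `ChoiceNO.RootHoldsNOW`, `RootHoldsNOWFn` and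
# **`samePDropOfSkeletonNeg₁_of_choiceFnNOW`** — the closure the node₁ file `SkelNeg1HoldsAll` will use

The interface of record `SkelNeg1ChoiceO` (p282003) is UNCHANGED (`ChoiceNO`, `ChoiceFnNO`, `GeomHoldsNOFn`, `FaceHoldsRNOFn`, `ReachHoldsRHNOFn`, stmt-g13's `negChoiceAllOF`); only the
ROOT obligation is restated: `RootHoldsNOW` asks for `Skel.RootOblTW` (the `RootOblT` clauses over an arbitrary weighting `W` plus the monotone transfer to the cube-pinned root law,
`SkelRootSeedLaw`), because with one Step-I″ link scale the root chain cannot run under the fully pinned cube law (memo §1).  `RootHoldsNO → RootHoldsNOW` (`Skel.rootOblTW_of_rootOblT`).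
builds on p205010 (kernel theorem, internal audit signed; external expert review pending) — nothing here uses p205010; `SamePDropOfSkeletonNeg₁` stays OPEN (conditional assembly).
Lane `prim-bschramm`, seat `prim-bschramm-p3` (gen 9; design owner + (R) owner); helper file (`--supports stmt-CriticalPhenomena-4575`).
[cite: KozmaNitzan2024, §4 Theorem 6 (pp. 25–31), Lemmas 10–12; §1 p. 2 (approach 1)] [cite: MartineauTassion2017, §3.4] [this work]
-/

noncomputable section

open MeasureTheory ProbabilityTheory
open scoped ENNReal Classical

namespace Summit.CriticalPhenomena.PercolationContinuityZ3.Theorems.Transplant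

open Literature.Probability.Percolation Literature.Probability.LatticeModels SimpleGraph KNCells KNLevels
open Literature.Barriers.CriticalPhenomena (HasExponentialGrowth)

/-! ## §0 The run-restricted obligations with the law-carrying root residue -/

namespace Skelφ

open GadgetSystem ProbeHistory HSiteScheme Contour
open Skel (winGraph winGraphIn RootOblTW ReachOblRHN)

variable {V : Type} [DecidableEq V] [Countable V] {G : SimpleGraph V} [G.LocallyFinite] {A : Type*}

/-- **The run-restricted obligations from the residues, root residue in the law-carrying form** (twin of `kitAtRun_of_oblRHNM` with `Skel.RootOblTW` and
`Skel.rootObl_of_rootOblTW`). [cite: KozmaNitzan2024, §4 (30), (32), Lemmas 10–12] -/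
theorem kitAtRun_of_oblRHNMW {S : KSchA V A} {FD : FaceData V A} {nmax Δ' : ℕ} {δ δ₂ ε'' : ℝ} {δr : ℕ → ℝ} (hδc : S.δc ≤ δ)
    (hstep : ∀ (c : V) (Rπ : ℕ) (Wg : Sym2 V → unitInterval) (s : KNLevels.TStep (winGraph G c Rπ)), s.KitsAt Wg S.p Δ' δ₂ →
      1 - δ₂ < (prodBernoulli Wg).real s.L.reachB → 1 - S.δc / 2 < (prodBernoulli Wg).real (⋃ t ∈ s.T, openConn s.L.o t))
    (hchain : ∀ n ≤ nmax, ∀ (Ω : Finset V) (Wg : Sym2 V → unitInterval) (s : Fin (n + 1) → KNLevels.TStep (winGraphIn G Ω))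
      (T' : Fin (n + 1) → Finset V) (η : ℝ),
      (∀ i : Fin (n + 1), (s i).L.o = (s 0).L.o) →
      (∀ i : Fin n, T' (Fin.castSucc i) ⊆ (s i.succ).L.X 0) →
      (∀ i : Fin (n + 1), T' i ⊆ (s i).T) →
      (∀ i : Fin (n + 1), (s i).KitsAt Wg S.p Δ' δ) →
      η ≤ δ / 2 →
      (∀ i : Fin (n + 1), (prodBernoulli Wg).real (⋃ t ∈ (s i).T \ T' i, openConn (s 0).L.o t) ≤ η) →
      1 - δ < (prodBernoulli Wg).real (s 0).L.reachB →
        1 - ε'' < (prodBernoulli Wg).real (⋃ t ∈ T' (Fin.last n), openConn (s 0).L.o t))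
    (hchainr : ∀ (n : ℕ) (c : V) (Rπ : ℕ) (Wg : Sym2 V → unitInterval) (s : Fin (n + 1) → KNLevels.TStep (winGraph G c Rπ))
      (T' : Fin (n + 1) → Finset V) (η : ℝ),
      (∀ i : Fin (n + 1), (s i).L.o = (s 0).L.o) →
      (∀ i : Fin n, T' (Fin.castSucc i) ⊆ (s i.succ).L.X 0) →
      (∀ i : Fin (n + 1), T' i ⊆ (s i).T) →
      (∀ i : Fin (n + 1), (s i).KitsAt Wg S.p Δ' (δr n)) →
      η ≤ δr n / 2 →
      (∀ i : Fin (n + 1), (prodBernoulli Wg).real (⋃ t ∈ (s i).T \ T' i, openConn (s 0).L.o t) ≤ η) →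
      1 - δr n < (prodBernoulli Wg).real (s 0).L.reachB →
        1 - S.δc < (prodBernoulli Wg).real (⋃ t ∈ T' (Fin.last n), openConn (s 0).L.o t))
    (hQ0 : RootOblTW G S Δ' δr) (hface : FaceOblRM G S FD Δ' δ₂) (hreach : ReachOblRHN G nmax S FD Δ' δ) :
    KSchA.KitAtRun G S FD δ₂ ε'' := by
  refine And.intro (Skel.rootObl_of_rootOblTW hchainr hQ0) (And.intro ?_ ?_)
  · intro h e hrun hc hV du hdu j hj o hsrc
    obtain ⟨ψ', hlipψ', hF⟩ := hface h e hrun hc hV du hdu j hj o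
    exact cond_of_faceOblAt hlipψ' hstep hF hsrc
  · intro h e hrun hc hV du hdu
    exact Skel.reach_of_reachOblAtHN hV hδc hchain (hreach h e hrun hc hV du hdu)

end Skelφ

namespace PlanarSkeletonNeg

open SkelConc (Consts)

/-! ## §1 The residue-level target, root residue law-carrying -/

/-- **THE N1 PARTIAL CLOSURE FROM THE THREE RESIDUES, ORIENTED, root residue as `Skel.RootOblTW`.**  As `samePDropOfSkeletonNeg₁_of_residuesNO` with `Skel.RootOblT`
replaced by `Skel.RootOblTW`. [cite: KozmaNitzan2024, §4 Theorem 6 (pp. 25–31); §1 p. 2 (approach 1)] [this work] -/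
theorem samePDropOfSkeletonNeg₁_of_residuesNOW
    (hres : ∀ (K₀ : ℕ) (δ δ₂ : ℝ) (δr : ℕ → ℝ), 0 < δ → δ ≤ 1 → 0 < δ₂ → δ₂ ≤ 1 → (∀ n, 0 < δr n ∧ δr n ≤ 1) →
      ∀ {V : Type} [DecidableEq V] [Countable V] (G : SimpleGraph V) [G.LocallyFinite] (Φ : PlanarSkeletonNeg G),
        ¬ HasExponentialGrowth G → ∀ t ∈ Φ.types, Φ.types = {t} → ∀ p : unitInterval, 0 < (p : ℝ) → (p : ℝ) < 1 →
          (∀ᵐ ω ∂bondPercolation G p, numInfiniteClusters ω ≤ 1) → ∀ hC : Φ.CylSubcritical p, 0 < theta G t p →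
            ∃ (δI : ℝ) (m₀ : ℕ), 0 < δI ∧ δI < 1 ∧
              ∀ O : Skelφ.StepI.OutO V, O.FactsO Φ.frame hC m₀ t →
                ∃ (Sz : Finset ℕ) (SMn : Finset (ℕ × ℕ)), (∀ M ∈ Sz, O.D.M₀ ≤ M) ∧ (∀ q ∈ SMn, O.D.M₀ ≤ q.1 ∧ O.D.n₁ q.1 ≤ q.2) ∧
                  ∀ q : unitInterval, (p : ℝ) / 2 ≤ q → (q : ℝ) ≤ p →
                    (∀ i ∈ Skelφ.StepI.indexNP {t} Sz SMn,
                      1 - δI < (bondPercolation G q).real (Skelφ.StepI.eventO G Φ.φ O.D O.DT O.ori i)) →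
                    Φ.CylSubcritical q →
                      ∃ (A : Type) (Γ : CellGeom V A) (FD : FaceData V A) (LD : LevelData V A),
                        Γ.root = t ∧ K₀ ≤ Γ.K ∧
                        RunGeom G Γ ∧ AnchGeom Γ ∧ SepGeom₂ G Γ ∧ ExitGeom G Γ ∧ StepsGeom Γ FD ∧ LevelGeom G Γ FD LD ∧
                        Skel.RootOblTW G (⟨Γ, q, δ⟩ : KSchA V A) Φ.Δ δr ∧
                        Skelφ.FaceOblRM G (⟨Γ, q, δ⟩ : KSchA V A) FD Φ.Δ δ₂ ∧
                        Skel.ReachOblRHN G Skel.nmaxN (⟨Γ, q, δ⟩ : KSchA V A) FD Φ.Δ δ) :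
    SamePDropOfSkeletonNeg₁ := by
  refine samePDropOfSkeletonNeg₁_of_stepI_runO fun {V} _ _ G _ Φ hg t ht h1 p hp0 hp1 hU hC hθ => ?_
  have hε' : (0 : ℝ) < (1 / 2) ^ 35 := by positivity
  have hΔ : ∀ v, G.degree v ≤ Φ.Δ := Φ.degree_le
  obtain ⟨δ, hδ0, hδ1, hchainH⟩ : ∃ δ : ℝ, 0 < δ ∧ δ ≤ 1 ∧ ∀ n ≤ Skel.nmaxN, ∀ (q : unitInterval), (q : ℝ) < 1 →
      ∀ (G' : SimpleGraph V) [G'.LocallyFinite], G' ≤ G →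
        ∀ (Wt : Sym2 V → unitInterval) (s : Fin (n + 1) → TStep G') (T' : Fin (n + 1) → Finset V) (η : ℝ),
        (∀ i : Fin (n + 1), (s i).L.o = (s 0).L.o) →
        (∀ i : Fin n, T' (Fin.castSucc i) ⊆ (s i.succ).L.X 0) →
        (∀ i : Fin (n + 1), T' i ⊆ (s i).T) →
        (∀ i : Fin (n + 1), (s i).KitsAt Wt q Φ.Δ δ) →
        η ≤ δ / 2 →
        (∀ i : Fin (n + 1), (prodBernoulli Wt).real (⋃ t ∈ (s i).T \ T' i, openConn (s 0).L.o t) ≤ η) →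
        1 - δ < (prodBernoulli Wt).real (s 0).L.reachB →
          1 - (1 / 2 : ℝ) ^ 35 < (prodBernoulli Wt).real (⋃ t ∈ T' (Fin.last n), openConn (s 0).L.o t) :=
    ⟨Skelφ.δCN G hΔ Skel.nmaxN ((1 / 2) ^ 35), Skelφ.δCN_pos G hΔ _ _, Skelφ.δCN_le_one G hΔ _ _,
      fun n hn q hq1 G' _ hG' => Skelφ.δCN_spec G hΔ hε' hn hq1 G' hG'⟩
  obtain ⟨δ₂, hδ₂0, hδ₂1, hstep⟩ := SkelConc.apply_step_subgraph_UP G hΔ (half_pos hδ0)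
  have hrc := fun n : ℕ => SkelConc.chain_edge_subgraph_UP G hΔ n hδ0
  choose δr hδr0 hδr1 hchainr using hrc
  obtain ⟨K₀, hK₀⟩ := exists_pow_lt_of_lt_one hε' (show 1 - δ₂ < 1 by linarith)
  obtain ⟨δI, m₀, hδI, hδI1, hS⟩ := hres K₀ δ δ₂ δr hδ0 hδ1 hδ₂0 hδ₂1 (fun n => ⟨hδr0 n, hδr1 n⟩) G Φ hg t ht h1 p hp0 hp1 hU hC hθ
  refine ⟨δI, m₀, hδI, hδI1, fun D DT ori hk₀ hk₁ hkM hR hΛ e1 e2 e3 e4 e5 hgeom => ?_⟩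
  obtain ⟨Sz, SMn, hSz, hSMn, hB⟩ := hS ⟨D, DT, ori⟩ ⟨hk₀, hk₁, hkM, hR, hΛ, e1, e2, e3, e4, e5, hgeom⟩
  refine ⟨Sz, SMn, hSz, hSMn, fun q hq1 hq2 hcq hCq => ?_⟩
  have hq1' : (q : ℝ) < 1 := lt_of_le_of_lt hq2 hp1
  obtain ⟨A, Γ, FD, LD, hroot, hK, hrun, hanch, hsep, hexit, hsteps, hlev, hrootO, hfaceO, hreachO⟩ := hB q hq1 hq2 hcq hCq
  refine ⟨A, ⟨Γ, q, δ⟩, FD, LD, (1 / 2) ^ 35, δ₂, hroot, rfl, hrun, hanch, hsep, hexit, hsteps, hlev, hδ1, hε'.le, hδ₂1, ?_, ?_⟩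
  · have hKpow : (1 - δ₂) ^ Γ.K ≤ (1 / 2 : ℝ) ^ 35 := (pow_le_pow_of_le_one (by linarith) (by linarith) hK).trans hK₀.le
    have h32 : (4 : ℝ) * ((1 / 2) ^ 35 + (1 / 2) ^ 35) = (1 / 2) ^ 32 := by norm_num
    show 4 * ((1 - δ₂) ^ Γ.K + (1 / 2 : ℝ) ^ 35) ≤ (1 / 2) ^ 32
    linarith
  · exact Skelφ.kitAtRun_of_oblRHNMW (S := ⟨Γ, q, δ⟩) le_rfl
      (fun c Rπ => hstep q hq1' (Skel.winGraph G c Rπ) (Skel.winGraph_le G c Rπ))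
      (fun n hn Ω => hchainH n hn q hq1' (Skel.winGraphIn G Ω) (Skel.winGraphIn_le G Ω))
      (fun n c Rπ => hchainr n q hq1' (Skel.winGraph G c Rπ) (Skel.winGraph_le G c Rπ)) hrootO hfaceO hreachO

/-! ## §2 The root obligation of a choice, law-carrying, and the node from an oriented choice function -/

variable {V : Type} [DecidableEq V] [Countable V] {G : SimpleGraph V} [G.LocallyFinite]

namespace ChoiceNO

variable {κ : Consts} {Φ : PlanarSkeletonNeg G} {t : V} {p : unitInterval} {hC : Φ.CylSubcritical p}

/-- **The root residue, oriented, LAW-CARRYING** ((R): a root chain under a law of its own plus the transfer; N1-R-PLAN v2). [this work] -/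
def RootHoldsNOW (𝒞 : ChoiceNO κ Φ t p hC) : Prop :=
  ∀ (O : Skelφ.StepI.OutO V) (q : unitInterval), 𝒞.AtQO O q → Skel.RootOblTW G (𝒞.scheme O q) Φ.Δ κ.δr

/-- The old root obligation implies the law-carrying one. [folklore] -/
theorem rootHoldsNOW_of_rootHoldsNO {𝒞 : ChoiceNO κ Φ t p hC} (h : 𝒞.RootHoldsNO) : 𝒞.RootHoldsNOW :=
  fun O q hat => Skel.rootOblTW_of_rootOblT (h O q hat)

end ChoiceNO

/-- The law-carrying root obligation of an oriented choice function. [this work] -/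
def RootHoldsNOWFn (𝒞₀ : ChoiceFnNO) : Prop :=
  ∀ (κ : Consts) {V : Type} [DecidableEq V] [Countable V] (G : SimpleGraph V) [G.LocallyFinite] (Φ : PlanarSkeletonNeg G)
    (hg : ¬ HasExponentialGrowth G) (t : V) (ht : t ∈ Φ.types) (h1 : Φ.types = {t}) (p : unitInterval) (hp0 : 0 < (p : ℝ)) (hp1 : (p : ℝ) < 1)
    (hC : Φ.CylSubcritical p), (𝒞₀ κ G Φ hg t ht h1 p hp0 hp1 hC).RootHoldsNOW

/-- `RootHoldsNOFn → RootHoldsNOWFn`. [folklore] -/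
theorem rootHoldsNOWFn_of_rootHoldsNOFn {𝒞₀ : ChoiceFnNO} (h : RootHoldsNOFn 𝒞₀) : RootHoldsNOWFn 𝒞₀ :=
  fun κ _ _ _ G _ Φ hg t ht h1 p hp0 hp1 hC => ChoiceNO.rootHoldsNOW_of_rootHoldsNO (h κ G Φ hg t ht h1 p hp0 hp1 hC)

/-- **THE N1 PARTIAL CLOSURE OF RECORD, oriented shared-choice form, root residue law-carrying**: an oriented choice function meeting the geometric, the
law-carrying root, the face and the corridor obligations gives `SamePDropOfSkeletonNeg₁`.  THIS is the closure the node₁ file `SkelNeg1HoldsAll` applies to stmt-g13's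
`negChoiceAllOF` (NEG-SCOPE B.12). [cite: KozmaNitzan2024, §4 Theorem 6 (pp. 25–31); §1 p. 2] [this work] -/
theorem samePDropOfSkeletonNeg₁_of_choiceFnNOW (𝒞₀ : ChoiceFnNO) (hGm : GeomHoldsNOFn 𝒞₀) (hR : RootHoldsNOWFn 𝒞₀) (hF : FaceHoldsRNOFn 𝒞₀)
    (hRe : ReachHoldsRHNOFn 𝒞₀) : SamePDropOfSkeletonNeg₁ := by
  refine samePDropOfSkeletonNeg₁_of_residuesNOW
    fun K₀ δ δ₂ δr hδ0 hδ1 hδ₂0 hδ₂1 hδr {V} _ _ G _ Φ hg t ht h1 p hp0 hp1 _ hC _ => ?_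
  set κ : Consts := ⟨K₀, δ, δ₂, δr, hδ0, hδ1, hδ₂0, hδ₂1, hδr⟩ with hκ
  set 𝒞 := 𝒞₀ κ G Φ hg t ht h1 p hp0 hp1 hC with h𝒞
  refine ⟨𝒞.δI, 𝒞.m₀, 𝒞.δI_pos, 𝒞.δI_lt_one, fun O hfacts => ?_⟩
  obtain ⟨hSz, hSMn⟩ := 𝒞.S_adm O hfacts
  refine ⟨𝒞.Sz O, 𝒞.SMn O, hSz, hSMn, fun q hq1 hq2 hin hCq => ?_⟩
  have hat : 𝒞.AtQO O q := ⟨hfacts, hq1, hq2, hin, hCq⟩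
  obtain ⟨hroot, hK, hrun, hanch, hsep, hexit, hsteps, hlev⟩ := hGm κ G Φ hg t ht h1 p hp0 hp1 hC O q hat
  exact ⟨ℕ, 𝒞.Γ O q, 𝒞.FD O q, 𝒞.LD O q, hroot, hK, hrun, hanch, hsep, hexit, hsteps, hlev,
    hR κ G Φ hg t ht h1 p hp0 hp1 hC O q hat, hF κ G Φ hg t ht h1 p hp0 hp1 hC O q hat, hRe κ G Φ hg t ht h1 p hp0 hp1 hC O q hat⟩

/-- The closure of record p282003 is the special case of a `RootOblT` root residue. [folklore] -/
theorem samePDropOfSkeletonNeg₁_of_choiceFnNO' (𝒞₀ : ChoiceFnNO) (hGm : GeomHoldsNOFn 𝒞₀) (hR : RootHoldsNOFn 𝒞₀) (hF : FaceHoldsRNOFn 𝒞₀)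
    (hRe : ReachHoldsRHNOFn 𝒞₀) : SamePDropOfSkeletonNeg₁ :=
  samePDropOfSkeletonNeg₁_of_choiceFnNOW 𝒞₀ hGm (rootHoldsNOWFn_of_rootHoldsNOFn hR) hF hRe

end PlanarSkeletonNeg

end Summit.CriticalPhenomena.PercolationContinuityZ3.Theorems.Transplant

end
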